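import Summits.RiemannHypothesis.RiemannHypothesis.Theorems.Splittings.LinearRayLehmerWindowDipTools

/-!
# The linear-factor ray at Lehmer's pair — soundness of the dip side

Cell rh-split (D-0116 arm), ENGINE 5 (rh-splitx-eng-5 g4), lane (xviii-D) «LEHMER WINDOW DATA», part DIP.
From the engine's representation `|Re H_0(2t) + K₀ Re F_0(½+it)| ≤ 10⁻⁶ K₀ ‖F_0(½+it)‖`
(`UniversalFactor.high_pointwise`, `F_0 = lehmerF t₀ 0 = lehmerCore t₀`) the dip bound
`−K₀·M ≤ Re H_0` on `[2t₁, 2t₀]` and the sign `0 < Re H_0(2t₁)` follow from (i) boxes of `F_0` at the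
grid points `t_k = (N₁+k)/B = t₁ + k/B` (`ldDipVals`, certified `ζ` evaluator), (ii) the interpolation slack
`u ≤ max(u(t_k), u(t_{k+1})) + 4M*/B²` for `u(t) = Re F_0(½+it)` (`dip_segment_bound`, from the tools file's
Cauchy estimate `|u''| ≤ 32 M*`), and (iii) the engine's segment bound `UniversalFactor.norm_lehmerF_half_le`
for the `10⁻⁶` term (`dip_repr`).  Main results: `ldDipCheck_sound` / `ldDipRunWith_sound`.
HONEST LABEL: RH-free negative-side bookkeeping on the linear-factor ray (RH-strengthening via
`riemannHypothesis_of_exists_linearRay`); not a splitting; nothing here bears on the truth of RH.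
-/


set_option linter.dupNamespace false

noncomputable section

namespace Summit.RiemannHypothesis.RiemannHypothesis.Theorems.Splittings.LinearRayLehmerWindow

open Set MeasureTheory Metric Complex
open Literature.NumberTheory.LFunctions Literature.NumberTheory.LFunctions.ZetaNumerics
open Literature.Analysis.ValidatedNumerics Literature.Analysis.ValidatedNumerics.NumericsMP
open Literature.Analysis.SpecialFunctions.Complex (stirlingPrim)

/-! ## The dip bound: three lemmas and the assembly -/

/-- Numerical frame of `t₀ = 7005.08`. [folklore] -/
theorem lehmerT0_bounds : 7000 ≤ UniversalFactor.lehmerT0 ∧ UniversalFactor.lehmerT0 ≤ 7010 := by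
  unfold UniversalFactor.lehmerT0 UniversalFactor.lehmerT0N UniversalFactor.lehmerT0D; norm_num

/-- **Interpolation on the dip segment.** If `u(t_k) ≤ V` at the grid points `t_k = t₁ + k/B`, `k ≤ G`,
`t_G = t₀`, `6990 ≤ t₁`, then `u ≤ V + 4M*/B²` on `[t₁, t₀]`, `u(t) = Re F_0(½+it)`,
`M* = 5(t₀+1)³ exp(¼ + (log t₀+3)/8 + (reSPR t₁ − reSPR t₀))`. [folklore] -/
theorem dip_segment_bound {t₁ V : ℝ} {B G : ℕ} (hB : 0 < B) (hG1 : 1 ≤ G)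
    (hGt : UniversalFactor.lehmerT0 - t₁ = (G : ℝ) / B) (ht₁ : 6990 ≤ t₁)
    (hnode : ∀ k ≤ G, (UniversalFactor.lehmerF UniversalFactor.lehmerT0 0 (1 / 2 + ((t₁ + k / B : ℝ) : ℂ) * I)).re ≤ V)
    {t : ℝ} (ht : t ∈ Icc t₁ UniversalFactor.lehmerT0) :
    (UniversalFactor.lehmerF UniversalFactor.lehmerT0 0 (1 / 2 + (t : ℂ) * I)).re ≤
      V + 4 * (5 * (UniversalFactor.lehmerT0 + 1) ^ 3 * Real.exp (1 / 4 + (Real.log UniversalFactor.lehmerT0 + 3) / 8 +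
        (UniversalFactor.reSPR t₁ - UniversalFactor.reSPR UniversalFactor.lehmerT0))) / (B : ℝ) ^ 2 := by
  have ht₀ := lehmerT0_bounds
  have hBr : (0 : ℝ) < B := by exact_mod_cast hB
  have ht₁pos : 0 < t₁ := by linarith
  -- the second-derivative bound on the segment
  have hderiv2 : ∀ s ∈ Icc t₁ UniversalFactor.lehmerT0,
      |(deriv (deriv (fun w : ℂ => UniversalFactor.lehmerF UniversalFactor.lehmerT0 0 (1 / 2 + w * I))) (s : ℂ)).re| ≤
        32 * (5 * (UniversalFactor.lehmerT0 + 1) ^ 3 * Real.exp (1 / 4 + (Real.log UniversalFactor.lehmerT0 + 3) / 8 +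
          (UniversalFactor.reSPR t₁ - UniversalFactor.reSPR UniversalFactor.lehmerT0))) := by
    intro s hs
    have hs4 : 4 ≤ s := by linarith [hs.1]
    have hs0 : 0 < s := by linarith
    have hb := norm_deriv2_Fv_le (t₀ := UniversalFactor.lehmerT0) hs4 (by linarith [ht₀.1])
    have e0 : (-0 * (s - UniversalFactor.lehmerT0) + |(0:ℝ)| * (1 / 4)) = 0 := by simp
    rw [e0, add_zero] at hb
    refine (Complex.abs_re_le_norm _).trans (hb.trans ?_)
    have hpow : (s + 1) ^ 3 ≤ (UniversalFactor.lehmerT0 + 1) ^ 3 :=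
      pow_le_pow_left₀ (by linarith) (by linarith [hs.2]) 3
    have hlg : Real.log s ≤ Real.log UniversalFactor.lehmerT0 := Real.log_le_log hs0 hs.2
    have hre : UniversalFactor.reSPR s ≤ UniversalFactor.reSPR t₁ := reSPR_antitone ht₁pos hs.1
    have hexp : Real.exp (1 / 4 + (Real.log s + 3) * (1 / 4) / 2 +
        (UniversalFactor.reSPR s - UniversalFactor.reSPR UniversalFactor.lehmerT0)) ≤
        Real.exp (1 / 4 + (Real.log UniversalFactor.lehmerT0 + 3) / 8 +
        (UniversalFactor.reSPR t₁ - UniversalFactor.reSPR UniversalFactor.lehmerT0)) :=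
      Real.exp_le_exp.2 (by linarith)
    have h5 : 5 * (s + 1) ^ 3 * Real.exp (1 / 4 + (Real.log s + 3) * (1 / 4) / 2 +
        (UniversalFactor.reSPR s - UniversalFactor.reSPR UniversalFactor.lehmerT0)) ≤
        5 * (UniversalFactor.lehmerT0 + 1) ^ 3 * Real.exp (1 / 4 + (Real.log UniversalFactor.lehmerT0 + 3) / 8 +
          (UniversalFactor.reSPR t₁ - UniversalFactor.reSPR UniversalFactor.lehmerT0)) :=
      mul_le_mul (mul_le_mul_of_nonneg_left hpow (by norm_num)) hexp (Real.exp_pos _).le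
        (mul_nonneg (by norm_num) (pow_nonneg (by linarith [ht₀.1]) 3))
    have e32 : ∀ X : ℝ, 2 * X / (1 / 4) ^ 2 = 32 * X := fun X => by ring
    rw [e32]
    linarith [h5]
  -- locate the grid cell of `t`
  set k : ℕ := min (Nat.floor ((t - t₁) * B)) (G - 1) with hkdef
  have hkG : k ≤ G - 1 := min_le_right _ _
  have hkG' : k + 1 ≤ G := by omega
  have hflo : (Nat.floor ((t - t₁) * B) : ℝ) ≤ (t - t₁) * B :=
    Nat.floor_le (mul_nonneg (by linarith [ht.1]) hBr.le)
  have hk_le : (k : ℝ) ≤ (t - t₁) * B := le_trans (by exact_mod_cast min_le_left _ _) hflo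
  have hp : t₁ + k / B ≤ t := by
    have : (k : ℝ) / B ≤ t - t₁ := by rw [div_le_iff₀ hBr]; exact hk_le
    linarith
  have hq : t ≤ t₁ + ((k + 1 : ℕ) : ℝ) / B := by
    rcases le_total (Nat.floor ((t - t₁) * B)) (G - 1) with hc | hc
    · have hk' : k = Nat.floor ((t - t₁) * B) := by rw [hkdef, min_eq_left hc]
      have hlt : (t - t₁) * B < (Nat.floor ((t - t₁) * B) : ℝ) + 1 := Nat.lt_floor_add_one _
      rw [← hk'] at hlt
      have : t - t₁ ≤ ((k : ℝ) + 1) / B := by rw [le_div_iff₀ hBr]; exact hlt.le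
      push_cast
      linarith
    · have hk' : k = G - 1 := by rw [hkdef, min_eq_right hc]
      have hkG'' : ((k + 1 : ℕ) : ℝ) = G := by rw [hk']; exact_mod_cast (Nat.sub_add_cancel hG1)
      rw [hkG'']
      linarith [ht.2]
  have hpq : t₁ + k / B ≤ t₁ + ((k + 1 : ℕ) : ℝ) / B := hp.trans hq
  have hk1G : ((k + 1 : ℕ) : ℝ) / B ≤ (G : ℝ) / B :=
    div_le_div_of_nonneg_right (by exact_mod_cast hkG') hBr.le
  have hk0 : (0 : ℝ) ≤ (k : ℝ) / B := by positivity
  have hsub : Icc (t₁ + k / B) (t₁ + ((k + 1 : ℕ) : ℝ) / B) ⊆ Icc t₁ UniversalFactor.lehmerT0 := fun s hs =>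
    ⟨by linarith [hs.1], by linarith [hs.2, hGt]⟩
  have hle := le_max_add_of_deriv2_bound
    (u := fun s : ℝ => (UniversalFactor.lehmerF UniversalFactor.lehmerT0 0 (1 / 2 + (s : ℂ) * I)).re) hpq
    (fun s => hasDerivAt_reFv UniversalFactor.lehmerT0 s) (fun s => hasDerivAt_reDerivFv UniversalFactor.lehmerT0 s)
    (fun s hs => hderiv2 s (hsub hs)) ⟨hp, hq⟩
  have h1 := hnode k (by omega)
  have h2 := hnode (k + 1) hkG'
  have e1 : ((t₁ + ((k + 1 : ℕ) : ℝ) / B : ℝ) : ℂ) = ((t₁ + ((k + 1 : ℕ) : ℕ) / B : ℝ) : ℂ) := by push_cast; ring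
  have hlen' : (t₁ + ((k + 1 : ℕ) : ℝ) / B) - (t₁ + k / B) = 1 / B := by push_cast; ring
  rw [hlen'] at hle
  have hmax : max ((UniversalFactor.lehmerF UniversalFactor.lehmerT0 0 (1 / 2 + ((t₁ + k / B : ℝ) : ℂ) * I)).re)
      ((UniversalFactor.lehmerF UniversalFactor.lehmerT0 0 (1 / 2 + ((t₁ + ((k + 1 : ℕ) : ℝ) / B : ℝ) : ℂ) * I)).re) ≤ V := by
    refine max_le h1 ?_
    have e2 : (((k + 1 : ℕ) : ℝ)) = ((k + 1 : ℕ) : ℕ) := by push_cast; ring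
    simpa using h2
  have e4 : ∀ X : ℝ, 32 * X * (1 / (B : ℝ)) ^ 2 / 8 = 4 * X / (B : ℝ) ^ 2 := fun X => by
    field_simp; ring
  rw [e4] at hle
  linarith [hle, hmax]

/-- **The representation on the dip segment**: for `t ∈ [t₁, t₀]`, `6990 ≤ t₁`,
`−K₀ · (Re F_0(½+it) + 10⁻⁶ · 25.3 (t₀+1)² e^{reSPR t₁ − reSPR t₀}) ≤ Re H_0(2t)`. [folklore] -/
theorem dip_repr {t₁ t : ℝ} (ht₁ : UniversalFactor.lehmerT0 - 10 ≤ t₁) (ht : t ∈ Icc t₁ UniversalFactor.lehmerT0) :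
    -(UniversalFactor.lehmerK0 UniversalFactor.lehmerT0 *
      ((UniversalFactor.lehmerF UniversalFactor.lehmerT0 0 (1 / 2 + (t : ℂ) * I)).re +
        (1 / 10 ^ 6) * (253 / 10 * (UniversalFactor.lehmerT0 + 1) ^ 2 *
          Real.exp (UniversalFactor.reSPR t₁ - UniversalFactor.reSPR UniversalFactor.lehmerT0)))) ≤
      (deBruijnH 0 ((2 * t : ℝ) : ℂ)).re := by
  have ht₀ := lehmerT0_bounds
  have hK := UniversalFactor.lehmerK0_pos UniversalFactor.lehmerT0
  have ht₁pos : 0 < t₁ := by linarith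
  have htpos : 0 < t := by linarith [ht.1]
  have ht1 : 6990 ≤ t := by linarith [ht.1]
  -- the segment bound
  have hD : (stirlingPrim (thetaArg t) - stirlingPrim (thetaArg UniversalFactor.lehmerT0)).re ≤
      UniversalFactor.reSPR t - UniversalFactor.reSPR UniversalFactor.lehmerT0 :=
    (re_stirlingPrim_sub htpos (by linarith [ht₀.1])).le
  have hseg := UniversalFactor.norm_lehmerF_half_le (t₀ := UniversalFactor.lehmerT0) (κ := 0) (T := t) (ρ := 0)
    le_rfl (by norm_num) (by have := Real.pi_lt_d2; linarith) (by linarith [ht.2, ht₀.2]) hD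
    (t := t) (by simp)
  have e0 : (Real.log t + 3) * 0 / 2 + (UniversalFactor.reSPR t - UniversalFactor.reSPR UniversalFactor.lehmerT0) +
      (-0 * (t - UniversalFactor.lehmerT0) + |(0:ℝ)| * 0) =
      UniversalFactor.reSPR t - UniversalFactor.reSPR UniversalFactor.lehmerT0 := by simp
  rw [e0] at hseg
  have hpow : (t + 1) ^ 2 ≤ (UniversalFactor.lehmerT0 + 1) ^ 2 := pow_le_pow_left₀ (by linarith) (by linarith [ht.2]) 2
  have hre : UniversalFactor.reSPR t ≤ UniversalFactor.reSPR t₁ := reSPR_antitone ht₁pos ht.1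
  have hseg' : ‖UniversalFactor.lehmerF UniversalFactor.lehmerT0 0 (1 / 2 + (t : ℂ) * I)‖ ≤
      253 / 10 * (UniversalFactor.lehmerT0 + 1) ^ 2 *
        Real.exp (UniversalFactor.reSPR t₁ - UniversalFactor.reSPR UniversalFactor.lehmerT0) :=
    hseg.trans (mul_le_mul (mul_le_mul_of_nonneg_left hpow (by norm_num)) (Real.exp_le_exp.2 (by linarith))
      (Real.exp_pos _).le (by positivity))
  -- the pointwise representation
  have habs : |t - UniversalFactor.lehmerT0| ≤ 81 / 8 := by
    rw [abs_le]; constructor <;> linarith [ht.1, ht.2]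
  have hp := UniversalFactor.high_pointwise (t₀ := UniversalFactor.lehmerT0) (t := t) 0 ht₀.1 habs
  simp only [neg_zero, zero_mul, Real.exp_zero, mul_one] at hp
  have h1 := (abs_le.1 hp).1
  have h2 : UniversalFactor.lehmerK0 UniversalFactor.lehmerT0 * (1 / 10 ^ 6) *
      ‖UniversalFactor.lehmerF UniversalFactor.lehmerT0 0 (1 / 2 + (t : ℂ) * I)‖ ≤
      UniversalFactor.lehmerK0 UniversalFactor.lehmerT0 * (1 / 10 ^ 6) *
        (253 / 10 * (UniversalFactor.lehmerT0 + 1) ^ 2 *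
          Real.exp (UniversalFactor.reSPR t₁ - UniversalFactor.reSPR UniversalFactor.lehmerT0)) :=
    mul_le_mul_of_nonneg_left hseg' (by positivity)
  linarith [h1, h2]

/-- **Soundness of the dip check** (`κ = 0`): with `t₁ = t₀ − G/B`, `0 < Re H_0(2t₁)` and
`−K₀·M ≤ Re H_0` on `[2t₁, 2t₀]`. [folklore] -/
theorem ldDipCheck_sound {C : UniversalFactor.LCtx} (hC : C.Valid) (hCt0 : C.t0 = UniversalFactor.lehmerT0)
    {B N₁ G n : ℕ} {κ : ℤ} {M : ℚ} (hκ : κ = 0) (h : ldDipCheck C B N₁ G n κ M = true) :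
    0 < (deBruijnH 0 ((2 * UniversalFactor.lehmerT0 - 2 * ((G : ℝ) / B) : ℝ) : ℂ)).re ∧
    ∀ r ∈ Icc (2 * UniversalFactor.lehmerT0 - 2 * ((G : ℝ) / B)) (2 * UniversalFactor.lehmerT0),
      -(UniversalFactor.lehmerK0 UniversalFactor.lehmerT0 * (M : ℝ)) ≤ (deBruijnH 0 (r : ℂ)).re := by
  have hS := hC.tv.S_pos
  have hSr : (0 : ℝ) < C.T.S := by exact_mod_cast hS
  have hK := UniversalFactor.lehmerK0_pos UniversalFactor.lehmerT0
  have ht₀ := lehmerT0_bounds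
  -- unpack the check
  unfold ldDipCheck at h
  simp only [Bool.and_eq_true, decide_eq_true_eq] at h
  obtain ⟨⟨hB, hBN, hG, hG10, hG1, hn⟩, h⟩ := h
  split at h
  · rename_i vals cs hvals hcs
    obtain ⟨Mstar, Mseg⟩ := cs
    simp only [Bool.and_eq_true, decide_eq_true_eq] at h
    obtain ⟨hMle, hsign⟩ := h
    subst hκ
    have hBr : (0 : ℝ) < B := by exact_mod_cast hB
    -- `t₁ = N₁/B = t₀ − G/B`
    have hGt : UniversalFactor.lehmerT0 - (N₁ : ℝ) / B = (G : ℝ) / B := by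
      have e : ((N₁ : ℝ) + G) * UniversalFactor.lehmerT0D = UniversalFactor.lehmerT0N * B := by exact_mod_cast hG
      unfold UniversalFactor.lehmerT0
      have hD : (0 : ℝ) < UniversalFactor.lehmerT0D := by unfold UniversalFactor.lehmerT0D; norm_num
      field_simp
      linarith
    have hG10r : (G : ℝ) / B ≤ 10 := by rw [div_le_iff₀ hBr]; exact_mod_cast hG10
    have ht₁ge' : UniversalFactor.lehmerT0 - 10 ≤ (N₁ : ℝ) / B := by linarith
    have ht₁ge : 6990 ≤ (N₁ : ℝ) / B := by linarith [ht₀.1]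
    have ht₁le : (N₁ : ℝ) / B ≤ UniversalFactor.lehmerT0 := by
      have : (0 : ℝ) ≤ (G : ℝ) / B := by positivity
      linarith
    have hBN' : B ≤ N₁ := le_trans (by omega) hBN
    -- data
    obtain ⟨hlen, hget⟩ := ldDipVals_spec C B N₁ 0 n hvals
    obtain ⟨hMstar, hMseg⟩ := ldDipConsts_sound hC hCt0 hB hBN' hcs
    have hnode : ∀ k < n,
        MC.mem C.T.S (UniversalFactor.lehmerF UniversalFactor.lehmerT0 0 (1 / 2 + (((N₁ : ℝ) / B + k / B : ℝ) : ℂ) * I))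
          (vals.getD k ⟨⟨0, 0⟩, ⟨0, 0⟩⟩) := by
      intro k hk
      have hm := UniversalFactor.mem_lehmerFBox hC hB (by omega) (hget k hk)
      rw [hCt0, Int.cast_zero] at hm
      have e : (((N₁ + k : ℕ) : ℝ) / B : ℝ) = (N₁ : ℝ) / B + k / B := by push_cast; ring
      rw [e] at hm
      exact hm
    have hnodeV : ∀ k ≤ G, (UniversalFactor.lehmerF UniversalFactor.lehmerT0 0
        (1 / 2 + (((N₁ : ℝ) / B + k / B : ℝ) : ℂ) * I)).re ≤ (ldMaxReHi vals : ℝ) / C.T.S := by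
      intro k hk
      have hkn : k < n := by rw [hn]; omega
      have h1 := MI.le_hi_div hS (hnode k hkn).1
      have h2 : (((vals.getD k ⟨⟨0, 0⟩, ⟨0, 0⟩⟩).re.hi : ℤ) : ℝ) ≤ (ldMaxReHi vals : ℝ) := by
        exact_mod_cast le_ldMaxReHi vals k (by rw [hlen]; exact hkn)
      exact h1.trans (div_le_div_of_nonneg_right h2 hSr.le)
    -- the total bound in reals
    have hq := (Rat.cast_le (K := ℝ)).2 hMle
    push_cast at hq
    have h4 : 4 * (5 * (UniversalFactor.lehmerT0 + 1) ^ 3 * Real.exp (1 / 4 + (Real.log UniversalFactor.lehmerT0 + 3) / 8 +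
        (UniversalFactor.reSPR ((N₁ : ℝ) / B) - UniversalFactor.reSPR UniversalFactor.lehmerT0))) / (B : ℝ) ^ 2 ≤
        4 * (Mstar : ℝ) / (B : ℝ) ^ 2 :=
      div_le_div_of_nonneg_right (by linarith) (by positivity)
    have h6 : (1 / 10 ^ 6) * (253 / 10 * (UniversalFactor.lehmerT0 + 1) ^ 2 *
        Real.exp (UniversalFactor.reSPR ((N₁ : ℝ) / B) - UniversalFactor.reSPR UniversalFactor.lehmerT0)) ≤
        (Mseg : ℝ) / 10 ^ 6 := by
      rw [div_eq_mul_one_div (Mseg : ℝ), mul_comm (Mseg : ℝ)]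
      exact mul_le_mul_of_nonneg_left hMseg (by norm_num)
    have e2t : 2 * UniversalFactor.lehmerT0 - 2 * ((G : ℝ) / B) = 2 * ((N₁ : ℝ) / B) := by linarith [hGt]
    constructor
    · -- the sign at `t₁`
      have hn0 : 0 < n := by omega
      have hm0 := hnode 0 hn0
      simp only [Nat.cast_zero, zero_div, add_zero] at hm0
      have hre := MI.le_hi_div hS hm0.1
      have hnm := MC.norm_le_absHi hm0
      have hnm' : ‖UniversalFactor.lehmerF UniversalFactor.lehmerT0 0 (1 / 2 + (((N₁ : ℝ) / B : ℝ) : ℂ) * I)‖ ≤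
          (((vals.getD 0 ⟨⟨0, 0⟩, ⟨0, 0⟩⟩).absHi : ℤ) : ℝ) / C.T.S := by
        rw [le_div_iff₀ hSr]; exact hnm
      have hsg : ((10 ^ 6 * (vals.getD 0 ⟨⟨0, 0⟩, ⟨0, 0⟩⟩).re.hi + (vals.getD 0 ⟨⟨0, 0⟩, ⟨0, 0⟩⟩).absHi : ℤ) : ℝ) < 0 := by
        exact_mod_cast hsign
      push_cast at hsg
      have hnum : ((((vals.getD 0 ⟨⟨0, 0⟩, ⟨0, 0⟩⟩).re.hi : ℤ) : ℝ) +
          (1 / 10 ^ 6) * (((vals.getD 0 ⟨⟨0, 0⟩, ⟨0, 0⟩⟩).absHi : ℤ) : ℝ)) / C.T.S < 0 :=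
        div_neg_of_neg_of_pos (by linarith) hSr
      have hrep := dip_repr (t := (N₁ : ℝ) / B) ht₁ge' ⟨le_rfl, ht₁le⟩
      have hsegle : (0 : ℝ) ≤ (1 / 10 ^ 6) * (253 / 10 * (UniversalFactor.lehmerT0 + 1) ^ 2 *
          Real.exp (UniversalFactor.reSPR ((N₁ : ℝ) / B) - UniversalFactor.reSPR UniversalFactor.lehmerT0)) := by
        positivity
      -- Re F + 10⁻⁶‖F‖ < 0 would suffice; we use the cruder pointwise box terms
      have hp := UniversalFactor.high_pointwise (t₀ := UniversalFactor.lehmerT0) (t := (N₁ : ℝ) / B) 0 ht₀.1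
        (by rw [abs_le]; constructor <;> linarith)
      simp only [neg_zero, zero_mul, Real.exp_zero, mul_one] at hp
      have h1 := (abs_le.1 hp).1
      rw [e2t]
      have key : (UniversalFactor.lehmerF UniversalFactor.lehmerT0 0 (1 / 2 + (((N₁ : ℝ) / B : ℝ) : ℂ) * I)).re +
          (1 / 10 ^ 6) * ‖UniversalFactor.lehmerF UniversalFactor.lehmerT0 0 (1 / 2 + (((N₁ : ℝ) / B : ℝ) : ℂ) * I)‖ < 0 := by
        have e : (((vals.getD 0 ⟨⟨0, 0⟩, ⟨0, 0⟩⟩).re.hi : ℤ) : ℝ) / C.T.S +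
            (1 / 10 ^ 6) * ((((vals.getD 0 ⟨⟨0, 0⟩, ⟨0, 0⟩⟩).absHi : ℤ) : ℝ) / C.T.S) =
            ((((vals.getD 0 ⟨⟨0, 0⟩, ⟨0, 0⟩⟩).re.hi : ℤ) : ℝ) +
              (1 / 10 ^ 6) * (((vals.getD 0 ⟨⟨0, 0⟩, ⟨0, 0⟩⟩).absHi : ℤ) : ℝ)) / C.T.S := by ring
        have hB' := add_le_add hre (mul_le_mul_of_nonneg_left hnm' (by norm_num : (0:ℝ) ≤ 1 / 10 ^ 6))
        rw [e] at hB'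
        exact hB'.trans_lt hnum
      have hprod := mul_neg_of_pos_of_neg hK key
      linarith [h1, hprod]
    · intro r hr
      have ht : r / 2 ∈ Icc ((N₁ : ℝ) / B) UniversalFactor.lehmerT0 := ⟨by linarith [hr.1, hGt], by linarith [hr.2]⟩
      have hrep := dip_repr ht₁ge' ht
      have e : ((2 * (r / 2) : ℝ) : ℂ) = (r : ℂ) := by push_cast; ring
      rw [e] at hrep
      have hi := dip_segment_bound hB hG1 hGt ht₁ge hnodeV ht
      have hsum : (UniversalFactor.lehmerF UniversalFactor.lehmerT0 0 (1 / 2 + ((r / 2 : ℝ) : ℂ) * I)).re +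
          (1 / 10 ^ 6) * (253 / 10 * (UniversalFactor.lehmerT0 + 1) ^ 2 *
            Real.exp (UniversalFactor.reSPR ((N₁ : ℝ) / B) - UniversalFactor.reSPR UniversalFactor.lehmerT0)) ≤ (M : ℝ) := by
        linarith [hi, h4, h6, hq]
      have hKM := mul_le_mul_of_nonneg_left hsum hK.le
      linarith [hrep, hKM]
  · simp at h

/-- **Soundness of the dip run**: a passing `ldDipRunWith` (`κ = 0`) on valid tables gives the sign at
`x₀ − L` and the dip bound on `[x₀ − L, x₀]`, `L = 2G/B`. [folklore] -/
theorem ldDipRunWith_sound {oT : Option Tables} (hT : ∀ T, oT = some T → T.Valid)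
    {B N₁ G n : ℕ} {κ : ℤ} {M : ℚ} (hκ : κ = 0) (h : ldDipRunWith oT B N₁ G n κ M = true) :
    0 < (deBruijnH 0 ((2 * UniversalFactor.lehmerT0 - 2 * ((G : ℝ) / B) : ℝ) : ℂ)).re ∧
    ∀ r ∈ Icc (2 * UniversalFactor.lehmerT0 - 2 * ((G : ℝ) / B)) (2 * UniversalFactor.lehmerT0),
      -(UniversalFactor.lehmerK0 UniversalFactor.lehmerT0 * (M : ℝ)) ≤ (deBruijnH 0 (r : ℂ)).re := by
  cases oT with
  | none => simp [ldDipRunWith] at h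
  | some T =>
    have hTv : T.Valid := hT T rfl
    unfold ldDipRunWith at h
    dsimp only at h
    split at h
    · simp at h
    · rename_i C hC
      obtain ⟨hCT, -, hN, hD⟩ := UniversalFactor.mkCtx_fields hC
      obtain ⟨h1, h2, h3, h4, h5, h6, h7⟩ := UniversalFactor.mkCtx_spec hTv hC
      have hCv : C.Valid := ⟨h1, h2, h3, h4, h5, h6, h7⟩
      have hCt0 : C.t0 = UniversalFactor.lehmerT0 := UniversalFactor.LCtx.t0_eq hN hD
      exact ldDipCheck_sound hCv hCt0 hκ h

end Summit.RiemannHypothesis.RiemannHypothesis.Theorems.Splittings.LinearRayLehmerWindow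

end
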